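import Summits.Ventures.HSemireg.WedgeHankelRecurrenceHankelCauchyIndex
import Summits.Ventures.HSemireg.WedgeHankelRecurrenceSignatureCauchyIndex

/-!
# Venture HSemireg — POSITIVE DEFINITE HANKEL FORMS OF RATIONAL FUNCTIONS: for `P` monic real of degree `t + 1` and ANY `Q`, **`H_t(Q/P) ≻ 0` (i.e. `sigPos = t + 1`) forces `P` to have
# `t + 1` DISTINCT REAL ROOTS (so `P` splits over `ℝ` and is separable), `gcd(P, Q) = 1` and `Ind(Q/P) = deg P`**; conversely `Ind(Q/P) = deg P` gives `sigPos H_t(Q/P) = t + 1`, `sigNeg = 0` — the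
# bound `|Ind(Q/P)| ≤ #roots_ℝ(P) ≤ deg P` read against N152's closed form `2·sigPos = deg(P/gcd) + Ind` (Hermite ∕ Hurwitz: the extremal Cauchy index characterises real-rooted `P` with a
# «positive partner» `Q`; the `Q = P′` case is N133's `splits_iff_sigNeg_hankelSq_eq_zero`)

HONEST FRAMING. Part of the Lean index of the computation cell `pub-hsemireg` (seat p10 gen 36, Sunday typer «UNIFORM-IN-n»).
LINEAR ALGEBRA OF HANKEL MATRICES AND REAL POLYNOMIALS ONLY (Mathlib's `sigPos` ∕ `sigNeg`; PROVED Literature `Algebra/Polynomial/CauchyIndex` — the public definitions `cauchyIndexAt`, `cauchyIndex` —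
imported through N150): no variety, no cohomology theory, no sheaf, no Ext group and no semiregularity map is constructed here; nothing here says that HC / HC_CM / HC_AV holds; no Literature fact
(unproved `Prop`) is declared or used.  Custodian versions as in `WedgeHankelSiegelIdeal` (1/3).
SOURCE OF THE ARGUMENT (cited; held text read, `book:basu2006-algorithms-real-algebraic-geometry` pp. 66–67, 326–335): BPR Definition 2.53 (each jump of `Q/P` contributes `±1` or `0` at a real root of
`P`, so `|Ind(Q/P; a, b)|` is at most the number of distinct real roots of `P` in `(a, b)`), Thm. 9.4 ∕ Prop. 9.20 (through N152); F. R. Gantmacher, *The Theory of Matrices* II (1959) Ch. XV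
§§9–11 (Hankel forms of rational functions: positive definiteness ⟺ index maximal; the «positive pair» criteria) for the classical context — only the statements listed below are typed.
DEDUP DISCLOSURE (`rg` of the whole tree + Mathlib, 2026-09-01): N133 has `P.Splits ↔ sigNeg H_t(P′/P) = 0` and `↔ H_t(P′/P)` non-negative (numerator `P′` only); N96 ∕ N113 count distinct roots by
ranks; N152 gives the closed forms; Literature `CauchyIndex` has no bound `|Ind| ≤ #roots`; NO file in the tree derives real-rootedness ∕ separability ∕ coprimality of `P` from the positivity of
`H_t(Q/P)` for an ARBITRARY numerator `Q`, nor characterises `sigPos H_t(Q/P) = deg P` by `Ind(Q/P) = deg P` or by `Q·P′ > 0` on the roots — that is this file.  13 names: 0 hits tree-wide.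

WHAT IS IN THE TREE (or staged ahead).  Literature `CauchyIndex`: `cauchyIndexAt P Q x` (an `if … then (if … then 1 else -1) else 0`), `cauchyIndex P Q a b = Σ_{x ∈ roots, a < x < b} cauchyIndexAt P Q x`;
N148 `sigPos_sub_sigNeg_hankelSq_dualSeq_real_of_separable` (`Sign H_t(a/P) = Σ_x sign(a(x)P′(x))`, separable `P`); N152 **`two_mul_sigPos_hankelSq_dualSeq_eq`**, **`two_mul_sigNeg_hankelSq_dualSeq_eq`**, `sigPos_add_sigNeg_hankelSq_dualSeq_eq_natDegree_div_gcd`; N101 `natDegree_div_gcd_add`; Mathlib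
`Polynomial.card_roots'` (`#roots ≤ deg`), `Multiset.toFinset_card_le`, `splits_iff_card_roots`, `nodup_roots_iff_of_splits`, `Multiset.toFinset_card_of_nodup`, `Multiset.dedup_card_eq_card_iff_nodup`.
THIS FILE (namespace `Summit.Ventures.HSemireg.Wedge.HankelOuter` continued; CHAINED on N152 + N148; 0 definitions):
* §777 THE BOUND: `abs_cauchyIndexAt_le_one`, **`abs_cauchyIndex_le_card_roots_toFinset`** (`|Ind(Q/P; a, b)| ≤ #roots_ℝ(P)`), `card_roots_toFinset_le_natDegree`, `cauchyIndex_le_natDegree` (`Ind(Q/P; a, b) ≤ deg P`).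
* §778 POSITIVE DEFINITE HANKEL FORMS (`P` monic real of degree `t + 1`, any `Q`, any window containing the real roots of `P`): **`card_roots_toFinset_eq_of_sigPos_hankelSq_eq`** (`sigPos H_t(Q/P) = t + 1 ⇒
  #roots_ℝ(P) = t + 1`), **`splits_and_separable_of_sigPos_hankelSq_eq`** (`⇒ P.Splits ∧ P.Separable`), `isCoprime_of_sigPos_hankelSq_eq` (`⇒ gcd(P, Q) = 1`), `cauchyIndex_eq_natDegree_of_sigPos_hankelSq_eq`
  (`⇒ Ind(Q/P) = t + 1`), and the converse **`sigPos_hankelSq_eq_of_cauchyIndex_eq`** (`Ind(Q/P) = t + 1 ⇒ sigPos H_t(Q/P) = t + 1 ∧ sigNeg H_t(Q/P) = 0`), packaged as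
  **`sigPos_hankelSq_eq_iff_cauchyIndex_eq`** (`sigPos H_t(Q/P) = t + 1 ⟺ Ind(Q/P) = deg P`).
* §779 THE POSITIVE-PAIR CRITERION (no window, no index): `sum_sign_eq_card_iff`, `card_roots_toFinset_eq_natDegree_of_splits_separable`,
  **`sigPos_hankelSq_eq_iff_splits_separable_forall_pos`** (`sigPos H_t(Q/P) = t + 1 ⟺ P.Splits ∧ P.Separable ∧ ∀ x ∈ roots P, Q(x)·P′(x) > 0` — N148's `Sign H_t(Q/P) = Σ_x sign(Q(x)P′(x))`).
CAVEATS.  `P` MONIC (Hankel side), size EXACTLY `t = deg P − 1` in §778 (the natural size; larger sizes have the same inertia by N136 but `sigPos = t + 1` is then impossible); `ℝ` only; «positive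
pair ∕ interlacing» is NOT given a definition here — the file stops at `Q·P′ > 0` on the roots (for `deg Q = deg P − 1` this is the interlacing of the roots of `P` and `Q`, not typed).
Nothing Ext-side.  New names only.
-/

open Module Polynomial
open scoped Matrix Polynomial

namespace Summit.Ventures.HSemireg.Wedge.HankelOuter

open Summit.Ventures.HSemireg.Wedge Summit.Ventures.HSemireg.Wedge.Hankel
open Literature.Algebra.Polynomial (cauchyIndexAt cauchyIndex)

/-! ## §777. `|Ind(Q/P; a, b)| ≤ #roots_ℝ(P) ≤ deg P` -/

/-- Each jump is `1`, `−1` or `0`: `|cauchyIndexAt P Q x| ≤ 1`. [bookkeeping; BPR Def. 2.53] -/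
theorem abs_cauchyIndexAt_le_one (P Q : ℝ[X]) (x : ℝ) : |cauchyIndexAt P Q x| ≤ 1 := by
  unfold cauchyIndexAt
  split_ifs <;> simp

/-- **`|Ind(Q/P; a, b)| ≤ #roots_ℝ(P)`** (the number of DISTINCT real roots of `P`; any `P`, `Q`, `a`, `b`). [this file, §777] -/
theorem abs_cauchyIndex_le_card_roots_toFinset (P Q : ℝ[X]) (a b : ℝ) : |cauchyIndex P Q a b| ≤ P.roots.toFinset.card := by
  unfold cauchyIndex
  refine (Finset.abs_sum_le_sum_abs _ _).trans ?_
  refine (Finset.sum_le_sum fun x _ => abs_cauchyIndexAt_le_one P Q x).trans ?_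
  rw [Finset.sum_const, nsmul_eq_mul, mul_one]
  exact_mod_cast Finset.card_filter_le _ _

/-- `#roots_ℝ(P) ≤ deg P` (distinct real roots). [bookkeeping; Mathlib `card_roots'`, `Multiset.toFinset_card_le`] -/
theorem card_roots_toFinset_le_natDegree (P : ℝ[X]) : P.roots.toFinset.card ≤ P.natDegree :=
  (Multiset.toFinset_card_le P.roots).trans (card_roots' P)

/-- **`Ind(Q/P; a, b) ≤ deg P`.** [this file, §777] -/
theorem cauchyIndex_le_natDegree (P Q : ℝ[X]) (a b : ℝ) : cauchyIndex P Q a b ≤ P.natDegree :=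
  (le_abs_self _).trans ((abs_cauchyIndex_le_card_roots_toFinset P Q a b).trans (by exact_mod_cast card_roots_toFinset_le_natDegree P))

/-! ## §778. `H_t(Q/P) ≻ 0` forces `t + 1` distinct real roots, coprimality and `Ind(Q/P) = deg P` -/

/-- **`sigPos H_t(Q/P) = t + 1` (positive definite) ⇒ `P` has `t + 1` DISTINCT REAL ROOTS** (`P` monic real of degree `t + 1`, any `Q`; N152: `2·sigPos = deg(P/gcd) + Ind ≤ (t + 1) + #roots_ℝ`).
[this file, §778] -/
theorem card_roots_toFinset_eq_of_sigPos_hankelSq_eq {t : ℕ} {P : ℝ[X]} (hP : P.Monic) (hPd : P.natDegree = t + 1) {Q : ℝ[X]} (hpos : sigPos (hankelSq ℝ t (dualSeq ℝ P Q)).toQuadraticForm' = t + 1) :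
    P.roots.toFinset.card = t + 1 := by
  classical
  obtain ⟨hi, hhi⟩ := (P.roots.toFinset.image id).bddAbove
  obtain ⟨lo, hlo⟩ := (P.roots.toFinset.image id).bddBelow
  have hroots : ∀ x ∈ P.roots, lo - 1 < x ∧ x < hi + 1 := fun x hx => by
    have hx' : x ∈ P.roots.toFinset.image id := Finset.mem_image.2 ⟨x, Multiset.mem_toFinset.2 hx, rfl⟩
    exact ⟨by linarith [hlo hx'], by linarith [hhi hx']⟩
  have h1 := two_mul_sigPos_hankelSq_dualSeq_eq hP hPd le_rfl Q hroots
  have h2 := abs_cauchyIndex_le_card_roots_toFinset P Q (lo - 1) (hi + 1)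
  have h3 := card_roots_toFinset_le_natDegree P
  have h4 : (P / EuclideanDomain.gcd P Q).natDegree ≤ t + 1 := by have := natDegree_div_gcd_add ℝ hP.ne_zero Q; omega
  rw [hpos] at h1
  rw [abs_le] at h2
  omega

/-- **`sigPos H_t(Q/P) = t + 1` ⇒ `P` splits over `ℝ` with simple roots.** [this file, §778] -/
theorem splits_and_separable_of_sigPos_hankelSq_eq {t : ℕ} {P : ℝ[X]} (hP : P.Monic) (hPd : P.natDegree = t + 1) {Q : ℝ[X]} (hpos : sigPos (hankelSq ℝ t (dualSeq ℝ P Q)).toQuadraticForm' = t + 1) :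
    P.Splits ∧ P.Separable := by
  classical
  have hcard := card_roots_toFinset_eq_of_sigPos_hankelSq_eq hP hPd hpos
  have h1 : P.roots.toFinset.card ≤ P.roots.card := Multiset.toFinset_card_le _
  have h2 : P.roots.card ≤ P.natDegree := card_roots' P
  have hsplits : P.Splits := splits_iff_card_roots.2 (by omega)
  refine ⟨hsplits, (nodup_roots_iff_of_splits hP.ne_zero hsplits).1 ?_⟩
  rw [← Multiset.dedup_card_eq_card_iff_nodup, ← Multiset.card_toFinset]
  omega

/-- **`sigPos H_t(Q/P) = t + 1` ⇒ `gcd(P, Q) = 1`** (the form is non-degenerate, so `rank H_t(Q/P) = deg(P/gcd) = t + 1`). [this file, §778] -/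
theorem isCoprime_of_sigPos_hankelSq_eq {t : ℕ} {P : ℝ[X]} (hP : P.Monic) (hPd : P.natDegree = t + 1) {Q : ℝ[X]} (hpos : sigPos (hankelSq ℝ t (dualSeq ℝ P Q)).toQuadraticForm' = t + 1) :
    IsCoprime P Q := by
  classical
  have h1 := sigPos_add_sigNeg_hankelSq_dualSeq_eq_natDegree_div_gcd (K := ℝ) hP hPd le_rfl Q
  have h2 := natDegree_div_gcd_add ℝ hP.ne_zero Q
  rw [hpos, hPd] at *
  have hg : (EuclideanDomain.gcd P Q).natDegree = 0 := by omega
  have hg0 : EuclideanDomain.gcd P Q ≠ 0 := fun h => hP.ne_zero (EuclideanDomain.gcd_eq_zero_iff.1 h).1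
  have hunit : IsUnit (EuclideanDomain.gcd P Q) := by
    rw [Polynomial.eq_C_of_natDegree_eq_zero hg]
    refine isUnit_C.2 (isUnit_iff_ne_zero.2 fun h => hg0 ?_)
    rw [Polynomial.eq_C_of_natDegree_eq_zero hg, h, map_zero]
  exact EuclideanDomain.gcd_isUnit_iff.1 hunit

/-- **`sigPos H_t(Q/P) = t + 1` ⇒ `Ind(Q/P) = t + 1 = deg P`** (any window containing the real roots of `P`). [this file, §778] -/
theorem cauchyIndex_eq_natDegree_of_sigPos_hankelSq_eq {t : ℕ} {P : ℝ[X]} (hP : P.Monic) (hPd : P.natDegree = t + 1) {Q : ℝ[X]} (hpos : sigPos (hankelSq ℝ t (dualSeq ℝ P Q)).toQuadraticForm' = t + 1)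
    {lo hi : ℝ} (hroots : ∀ x ∈ P.roots, lo < x ∧ x < hi) : cauchyIndex P Q lo hi = t + 1 := by
  classical
  have h1 := two_mul_sigPos_hankelSq_dualSeq_eq hP hPd le_rfl Q hroots
  have h2 := cauchyIndex_le_natDegree P Q lo hi
  have h4 : (P / EuclideanDomain.gcd P Q).natDegree ≤ t + 1 := by have := natDegree_div_gcd_add ℝ hP.ne_zero Q; omega
  rw [hpos] at h1
  rw [hPd] at h2
  push_cast at h1 h2 ⊢
  omega

/-- **Conversely, `Ind(Q/P) = deg P` ⇒ `sigPos H_t(Q/P) = t + 1` and `sigNeg H_t(Q/P) = 0`** (`P` monic real of degree `t + 1`, roots of `P` in the window). [this file, §778] -/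
theorem sigPos_hankelSq_eq_of_cauchyIndex_eq {t : ℕ} {P : ℝ[X]} (hP : P.Monic) (hPd : P.natDegree = t + 1) (Q : ℝ[X]) {lo hi : ℝ} (hroots : ∀ x ∈ P.roots, lo < x ∧ x < hi)
    (hind : cauchyIndex P Q lo hi = t + 1) :
    sigPos (hankelSq ℝ t (dualSeq ℝ P Q)).toQuadraticForm' = t + 1 ∧ sigNeg (hankelSq ℝ t (dualSeq ℝ P Q)).toQuadraticForm' = 0 := by
  classical
  have h1 := two_mul_sigPos_hankelSq_dualSeq_eq hP hPd le_rfl Q hroots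
  have h2 := two_mul_sigNeg_hankelSq_dualSeq_eq hP hPd le_rfl Q hroots
  have h4 : (P / EuclideanDomain.gcd P Q).natDegree ≤ t + 1 := by have := natDegree_div_gcd_add ℝ hP.ne_zero Q; omega
  rw [hind] at h1 h2
  constructor <;> omega

/-- **`sigPos H_t(Q/P) = t + 1 ⟺ Ind(Q/P) = deg P`** (`P` monic real of degree `t + 1`, any `Q`, roots of `P` in the window): the Hankel form of `Q/P` is positive definite exactly when the Cauchy
index is maximal. [this file, §778] -/
theorem sigPos_hankelSq_eq_iff_cauchyIndex_eq {t : ℕ} {P : ℝ[X]} (hP : P.Monic) (hPd : P.natDegree = t + 1) (Q : ℝ[X]) {lo hi : ℝ} (hroots : ∀ x ∈ P.roots, lo < x ∧ x < hi) :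
    sigPos (hankelSq ℝ t (dualSeq ℝ P Q)).toQuadraticForm' = t + 1 ↔ cauchyIndex P Q lo hi = t + 1 :=
  ⟨fun h => cauchyIndex_eq_natDegree_of_sigPos_hankelSq_eq hP hPd h hroots, fun h => (sigPos_hankelSq_eq_of_cauchyIndex_eq hP hPd Q hroots h).1⟩

/-! ## §779. The positive-pair criterion: `H_t(Q/P) ≻ 0 ⟺ P` has `t + 1` simple real roots and `Q·P′ > 0` at each of them -/

/-- `Σ_{x ∈ S} sign f(x) = #S ⟺ f > 0 on S` (each sign is `≤ 1`). [bookkeeping] -/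
theorem sum_sign_eq_card_iff {ι : Type*} (S : Finset ι) (f : ι → ℝ) : (∑ x ∈ S, (SignType.sign (f x) : ℤ)) = S.card ↔ ∀ x ∈ S, 0 < f x := by
  classical
  have hle : ∀ x ∈ S, (SignType.sign (f x) : ℤ) ≤ 1 := fun x _ => by
    rcases lt_trichotomy 0 (f x) with h | h | h
    · rw [sign_pos h]; exact le_rfl
    · rw [← h, sign_zero]; norm_num
    · rw [sign_neg h]; norm_num
  constructor
  · intro h x hx
    by_contra hx0
    have hxle : (SignType.sign (f x) : ℤ) ≤ 0 := by
      rcases (not_lt.1 hx0).lt_or_eq with h0 | h0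
      · rw [sign_neg h0]; norm_num
      · rw [h0, sign_zero]; exact le_rfl
    have hlt : ∑ y ∈ S, (SignType.sign (f y) : ℤ) < S.card := by
      calc ∑ y ∈ S, (SignType.sign (f y) : ℤ) = ∑ y ∈ S.erase x, (SignType.sign (f y) : ℤ) + SignType.sign (f x) := (Finset.sum_erase_add _ _ hx).symm
        _ ≤ ∑ _y ∈ S.erase x, (1 : ℤ) + 0 := add_le_add (Finset.sum_le_sum fun y hy => hle y (Finset.mem_of_mem_erase hy)) hxle
        _ < S.card := by
          rw [Finset.sum_const, nsmul_eq_mul, mul_one, add_zero, Finset.card_erase_of_mem hx]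
          have := Finset.card_pos.2 ⟨x, hx⟩
          omega
    exact (ne_of_lt hlt) h
  · intro h
    rw [Finset.sum_congr rfl fun x hx => by rw [sign_pos (h x hx)], Finset.sum_const, nsmul_eq_mul, SignType.coe_one, mul_one]

/-- `P` splits with simple roots ⇒ `#roots_ℝ(P) = deg P` (distinct roots). [bookkeeping; Mathlib `splits_iff_card_roots`, `nodup_roots_iff_of_splits`] -/
theorem card_roots_toFinset_eq_natDegree_of_splits_separable {P : ℝ[X]} (hP : P ≠ 0) (hs : P.Splits) (hsep : P.Separable) : P.roots.toFinset.card = P.natDegree := by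
  classical
  rw [Multiset.card_toFinset, Multiset.dedup_card_eq_card_iff_nodup.2 ((nodup_roots_iff_of_splits hP hs).2 hsep)]
  exact splits_iff_card_roots.1 hs

/-- **THE POSITIVE-PAIR CRITERION: `sigPos H_t(Q/P) = t + 1 ⟺ P` splits over `ℝ` with simple roots AND `Q(x)·P′(x) > 0` at every real root `x` of `P`** (`P` monic real of degree `t + 1`, any
`Q`; no window, no Cauchy index in the statement: §778 for the roots, N148's `Sign H_t(Q/P) = Σ_x sign(Q(x)P′(x))` for separable `P`, and `Σ sign = #roots ⟺` all signs are `+1`).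
[this file, §779] -/
theorem sigPos_hankelSq_eq_iff_splits_separable_forall_pos {t : ℕ} {P : ℝ[X]} (hP : P.Monic) (hPd : P.natDegree = t + 1) (Q : ℝ[X]) :
    sigPos (hankelSq ℝ t (dualSeq ℝ P Q)).toQuadraticForm' = t + 1 ↔ P.Splits ∧ P.Separable ∧ ∀ x ∈ P.roots, 0 < Q.eval x * (derivative P).eval x := by
  classical
  have hsum := sigPos_add_sigNeg_hankelSq_dualSeq_eq_natDegree_div_gcd (K := ℝ) hP hPd le_rfl Q
  have hdiv : (P / EuclideanDomain.gcd P Q).natDegree ≤ t + 1 := by have := natDegree_div_gcd_add ℝ hP.ne_zero Q; omega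
  constructor
  · intro hpos
    obtain ⟨hs, hsep⟩ := splits_and_separable_of_sigPos_hankelSq_eq hP hPd hpos
    have hcard := card_roots_toFinset_eq_of_sigPos_hankelSq_eq hP hPd hpos
    have hsig := sigPos_sub_sigNeg_hankelSq_dualSeq_real_of_separable hP hsep hPd.le Q
    rw [hpos] at hsig hsum
    have hneg : sigNeg (hankelSq ℝ t (dualSeq ℝ P Q)).toQuadraticForm' = 0 := by omega
    rw [hneg] at hsig
    refine ⟨hs, hsep, fun x hx => (sum_sign_eq_card_iff P.roots.toFinset fun x => Q.eval x * (derivative P).eval x).1 ?_ x (Multiset.mem_toFinset.2 hx)⟩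
    rw [← hsig, hcard]
    push_cast
    ring
  · rintro ⟨hs, hsep, hall⟩
    have hcard := card_roots_toFinset_eq_natDegree_of_splits_separable hP.ne_zero hs hsep
    have hsig := sigPos_sub_sigNeg_hankelSq_dualSeq_real_of_separable hP hsep hPd.le Q
    rw [(sum_sign_eq_card_iff P.roots.toFinset fun x => Q.eval x * (derivative P).eval x).2 fun x hx => hall x (Multiset.mem_toFinset.1 hx), hcard, hPd] at hsig
    push_cast at hsig
    omega

end Summit.Ventures.HSemireg.Wedge.HankelOuter
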